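import Summits.AtomisticToContinuum.Crystallization.Theorems.FrustratedLawDichotomyCellKitW

/-!
# FrustratedLawDichotomy · crux `AperiodicFrustratedLawGap` (stmt-AtomisticToContinuum-27623) — CELL CERTIFICATE KIT, part F:
# certifiable FLAGS of a finite motif (radial obstruction to goodness; hcp fit with an explicit isometry) and the supercell ENUMERATION
# (decomp-a2c, prover hand 1, generation 15; critic row 564 (i))

The periodic-block negative kernel (`…PeriodicBlockViolation.not_schurElasticPricing_of_cell`) asks, for every class centre of the supercell
motif `superMotif x a μ σ`, a certified `GoodAtScale η₁ D` flag and a certified `¬ MaybeGoodAt η₀ D` flag, and an enumeration `(μ, σ)` of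
`Fin N₀ × [−k₀, k₀]³` with class centres `cidx`.  This part supplies:

* §1 ★ `not_goodAt_of_radial` — the ROTATION-FREE obstruction: if `d₀` is the nearest-neighbour distance of the centre and some point of the
  configuration lies at distance in `[(1 + ηmax)·d₀, 13/10·d₀)`, then the centre is NOT `ηmax`-good for ANY isometry and ANY assignment (the
  matched copy `d₀ • A u` of a unit pattern vector has norm exactly `d₀`, so a matched point at radius `≥ (1 + ηmax) d₀` has residual
  `≥ ηmax·d₀`); hence `not_goodAtScale_of_radial`, `not_maybeGoodAt_of_radial`.  (For hand-1 g14's all-strained witness cells the `1/20`-misfit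
  is purely radial — `r₁₂/d = 1.05035` at every site — so this loses nothing there.)
* §2 `goodAtScale_hcp_of_fit` — the hcp branch of `GoodAtScale` from an explicit isometry `A`, an explicit assignment `φ` of the twelve
  pattern points and the clause list; `norm_sub_smul_le_of_cert` — the fit inequality `‖v − d₀ • (ε • u)‖ ≤ η·d₀` for an INTEGER vector
  `v = intVec V`, `d₀ = √Qn`, `u = (√N)⁻¹ • intVec h`, `ε = ±1`, from ONE integer inequality `(|V|² + Qn(1 − η²))²·N ≤ 4·Qn·G²`,
  `G = ε⟪V, h⟫ ≥ 0` (no square roots left); `hcpPattern_exists_tab` — every hcp pattern point is `(√18)⁻¹ • intVec (hcpTab i)`.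
* §3 the ENUMERATION `cellμ / cellσ / cellIdx` of `Fin N₀ × [−k₀, k₀]³` by `Fin (N₀·(2k₀+1)³)` (via `finProdFinEquiv`, `finFunctionFinEquiv`)
  with the four kernel hypotheses `cellμσ_injective`, `abs_cellσ_le`, `cell_sup`, `cellIdx_spec`, and the sum re-indexing `sum_cell_eq`.

All `[folklore]`; 0 sorry.
-/

noncomputable section

namespace Summit.AtomisticToContinuum.Crystallization.Theorems.FrustratedLawDichotomyCellKitF

open scoped BigOperators RealInnerProductSpace
open Literature.Geometry.DiscreteGeometry (intVec sqNormInt norm_intVec intVec_sub intVec_apply intVec_add intVec_zsmul inner_intVec dotInt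
  fccKissingPattern hcpKissingPattern hcpInt hcpTab hcpInt_eq_image scaledPattern norm_eq_one_of_mem_fccKissingPattern
  norm_eq_one_of_mem_hcpKissingPattern)
open Summit.AtomisticToContinuum.Crystallization.Theorems.ChargedEnergyGapNegative (E3)
open Summit.AtomisticToContinuum.Crystallization.Theorems.FrustratedLawDichotomyRangeCut (GoodAt)
open Summit.AtomisticToContinuum.Crystallization.Theorems.FrustratedLawDichotomyMotifLemmas (GoodAtScale GoodAtScale.goodAt)
open Summit.AtomisticToContinuum.Crystallization.Theorems.FrustratedLawDichotomyMotifDoorE (MaybeGoodAt)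

/-! ## §1. The radial obstruction to goodness -/

/-- The clause list of the two-shell fit predicate (either branch, pattern `v` of unit vectors) is incompatible with a configuration point at
distance in `[(1 + ηmax)·d₀, 13/10·d₀)` from the centre, `d₀` the nearest-neighbour distance. [folklore] -/
theorem clauses_radial_false {P : Type*} (v : P → E3) (hv : ∀ u, ‖v u‖ = 1) {X : Set E3} {p : E3} {d η ηmax γ d₀ : ℝ}
    {A : E3 →ₗᵢ[ℝ] E3} {t : P → E3}
    (h : 0 < d ∧ 0 < γ ∧ η < ηmax ∧ (∀ u, t u ∈ X ∧ ‖(t u - p) - d • A (v u)‖ ≤ η * d) ∧ (∀ s, s ∈ X → s ≠ p → d ≤ dist s p) ∧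
      (∃ s, s ∈ X ∧ s ≠ p ∧ dist s p ≤ d) ∧
      (∀ s, s ∈ X → s ≠ p → dist s p < 13 / 10 * d + γ → dist s p ≤ 13 / 10 * d - γ ∧ s ∈ Set.range t))
    (hpin : ∀ s, s ∈ X → s ≠ p → d₀ ≤ dist s p) (hnn : ∃ s, s ∈ X ∧ s ≠ p ∧ dist s p ≤ d₀)
    (hfar : ∃ s, s ∈ X ∧ (1 + ηmax) * d₀ ≤ dist s p ∧ dist s p < 13 / 10 * d₀) (hη : 0 ≤ ηmax) : False := by
  obtain ⟨hd, hγ, hηlt, hfit, hpin', hnn', hclean⟩ := h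
  have hdd : d = d₀ := by
    obtain ⟨s, hs, hsp, hle⟩ := hnn'
    obtain ⟨s', hs', hsp', hle'⟩ := hnn
    exact le_antisymm ((hpin' s' hs' hsp').trans hle') ((hpin s hs hsp).trans hle)
  subst hdd
  obtain ⟨s, hs, hge, hlt⟩ := hfar
  have hsp : s ≠ p := by
    intro h
    rw [h, dist_self] at hge
    nlinarith
  obtain ⟨-, ⟨u, rfl⟩⟩ := hclean s hs hsp (by linarith)
  have hres := (hfit u).2
  have hnorm : ‖d • A (v u)‖ = d := by rw [norm_smul, LinearIsometry.norm_map, hv, mul_one, Real.norm_of_nonneg hd.le]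
  have htri : ‖t u - p‖ ≤ ‖(t u - p) - d • A (v u)‖ + ‖d • A (v u)‖ := norm_le_norm_sub_add _ _
  rw [hnorm, ← dist_eq_norm] at htri
  nlinarith

/-- ★ **RADIAL OBSTRUCTION**: nearest-neighbour distance `d₀` at the centre `c` of `z` and a point of `z` at distance in `[(1 + ηmax)·d₀, 13/10·d₀)`
⟹ `¬ GoodAt ηmax z c` (no isometry, no assignment can fit). [folklore] -/
theorem not_goodAt_of_radial {ηmax : ℝ} {M : ℕ} {z : Fin M → E3} {c : Fin M} {d₀ : ℝ} (hη : 0 ≤ ηmax)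
    (hpin : ∀ a, z a ≠ z c → d₀ ≤ dist (z a) (z c)) (hnn : ∃ a, z a ≠ z c ∧ dist (z a) (z c) ≤ d₀)
    (hfar : ∃ a, (1 + ηmax) * d₀ ≤ dist (z a) (z c) ∧ dist (z a) (z c) < 13 / 10 * d₀) : ¬ GoodAt ηmax z c := by
  rintro ⟨d, η, γ, A, hor⟩
  have hpin' : ∀ s, s ∈ Set.range z → s ≠ z c → d₀ ≤ dist s (z c) := by rintro _ ⟨a, rfl⟩ h; exact hpin a h
  have hnn' : ∃ s, s ∈ Set.range z ∧ s ≠ z c ∧ dist s (z c) ≤ d₀ := by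
    obtain ⟨a, h1, h2⟩ := hnn; exact ⟨z a, ⟨a, rfl⟩, h1, h2⟩
  have hfar' : ∃ s, s ∈ Set.range z ∧ (1 + ηmax) * d₀ ≤ dist s (z c) ∧ dist s (z c) < 13 / 10 * d₀ := by
    obtain ⟨a, h1, h2⟩ := hfar; exact ⟨z a, ⟨a, rfl⟩, h1, h2⟩
  rcases hor with ⟨t, h⟩ | ⟨t, h⟩
  · exact clauses_radial_false (fun u : ↥fccKissingPattern => (u : E3)) (fun u => norm_eq_one_of_mem_fccKissingPattern u.2)
      h hpin' hnn' hfar' hη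
  · exact clauses_radial_false (fun u : ↥hcpKissingPattern => (u : E3)) (fun u => norm_eq_one_of_mem_hcpKissingPattern u.2)
      h hpin' hnn' hfar' hη

/-- The capped form. [folklore] -/
theorem not_goodAtScale_of_radial {ηmax D : ℝ} {M : ℕ} {z : Fin M → E3} {c : Fin M} {d₀ : ℝ} (hη : 0 ≤ ηmax)
    (hpin : ∀ a, z a ≠ z c → d₀ ≤ dist (z a) (z c)) (hnn : ∃ a, z a ≠ z c ∧ dist (z a) (z c) ≤ d₀)
    (hfar : ∃ a, (1 + ηmax) * d₀ ≤ dist (z a) (z c) ∧ dist (z a) (z c) < 13 / 10 * d₀) : ¬ GoodAtScale ηmax D z c :=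
  fun h => not_goodAt_of_radial hη hpin hnn hfar h.goodAt

/-- ★ **`¬ MaybeGoodAt` from the radial obstruction and a point within `D` of the centre.** [folklore] -/
theorem not_maybeGoodAt_of_radial {ηmax D : ℝ} {M : ℕ} {z : Fin M → E3} {c : Fin M} {d₀ : ℝ} (hη : 0 ≤ ηmax)
    (hpin : ∀ a, z a ≠ z c → d₀ ≤ dist (z a) (z c)) (hnn : ∃ a, z a ≠ z c ∧ dist (z a) (z c) ≤ d₀)
    (hfar : ∃ a, (1 + ηmax) * d₀ ≤ dist (z a) (z c) ∧ dist (z a) (z c) < 13 / 10 * d₀)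
    (hnear : ∃ a, a ≠ c ∧ dist (z a) (z c) ≤ D) : ¬ MaybeGoodAt ηmax D z c := by
  rintro (h | h)
  · exact not_goodAtScale_of_radial hη hpin hnn hfar h
  · obtain ⟨a, hac, hle⟩ := hnear
    exact absurd (h a hac) (not_lt.2 hle)

/-! ## §2. Goodness from an explicit fit -/

/-- **The hcp branch of `GoodAtScale` from explicit data**: isometry `A`, assignment `φ` of the twelve pattern points, scale `d₀ ≤ D` equal to the
nearest-neighbour distance (pinning clauses), residuals `≤ η·d₀` with `η < ηmax`, and the clean shell with gap `γ`. [folklore] -/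
theorem goodAtScale_hcp_of_fit {ηmax D : ℝ} {M : ℕ} {z : Fin M → E3} {c : Fin M} {d₀ η γ : ℝ} (A : E3 →ₗᵢ[ℝ] E3)
    (φ : ↥hcpKissingPattern → Fin M) (hd : 0 < d₀) (hdD : d₀ ≤ D) (hγ : 0 < γ) (hη : η < ηmax)
    (hfit : ∀ u, ‖(z (φ u) - z c) - d₀ • A (u : E3)‖ ≤ η * d₀)
    (hpin : ∀ a, z a ≠ z c → d₀ ≤ dist (z a) (z c)) (hnn : ∃ a, z a ≠ z c ∧ dist (z a) (z c) ≤ d₀)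
    (hclean : ∀ a, z a ≠ z c → dist (z a) (z c) < 13 / 10 * d₀ + γ → dist (z a) (z c) ≤ 13 / 10 * d₀ - γ ∧ ∃ u, z (φ u) = z a) :
    GoodAtScale ηmax D z c := by
  refine ⟨d₀, η, γ, A, hdD, Or.inr ⟨fun u => z (φ u), hd, hγ, hη, fun u => ⟨⟨φ u, rfl⟩, hfit u⟩, ?_, ?_, ?_⟩⟩
  · rintro _ ⟨a, rfl⟩ h; exact hpin a h
  · obtain ⟨a, h1, h2⟩ := hnn; exact ⟨z a, ⟨a, rfl⟩, h1, h2⟩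
  · rintro _ ⟨a, rfl⟩ h1 h2
    obtain ⟨h3, u, hu⟩ := hclean a h1 h2
    exact ⟨h3, u, hu⟩

/-- Every hcp pattern point is `(√18)⁻¹ • intVec (hcpTab i)` for some `i : Fin 12`. [folklore] -/
theorem hcpPattern_exists_tab (u : ↥hcpKissingPattern) : ∃ i : Fin 12, (u : E3) = (Real.sqrt 18)⁻¹ • intVec (hcpTab i) := by
  have hu : (u : E3) ∈ scaledPattern hcpInt 18 := u.2
  rw [scaledPattern, hcpInt_eq_image, Finset.image_image] at hu
  obtain ⟨i, -, hi⟩ := Finset.mem_image.1 hu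
  exact ⟨i, by rw [← hi]; simp⟩

/-- ★ **The fit inequality from one integer inequality.**  `‖intVec V − √Qn • (ε • (√N)⁻¹ • intVec h)‖ ≤ η·√Qn` for `ε = ±1`, `|h|² = N ≠ 0`,
`0 ≤ η ≤ 1`, `G = ε·⟪V,h⟫ ≥ 0` and `(|V|² + Qn(1 − η²))²·N ≤ 4·Qn·G²`. [folklore] -/
theorem norm_sub_smul_le_of_cert {V h : Fin 3 → ℤ} {N : ℕ} (hN : N ≠ 0) (hh : sqNormInt h = N) {Qn : ℕ}
    {ε : ℝ} (hε : ε = 1 ∨ ε = -1) {η : ℚ} (hη0 : 0 ≤ η) (hη1 : η ≤ 1) {G : ℤ} (hGε : (G : ℝ) = ε * dotInt V h) (hG0 : 0 ≤ G)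
    (hcert : ((sqNormInt V : ℚ) + Qn * (1 - η ^ 2)) ^ 2 * N ≤ 4 * Qn * (G : ℚ) ^ 2) :
    ‖intVec V - Real.sqrt Qn • (ε • ((Real.sqrt N)⁻¹ • intVec h))‖ ≤ η * Real.sqrt Qn := by
  have norm_intVec_sq : ‖intVec V‖ ^ 2 = (sqNormInt V : ℝ) := by
    have h0 : (0 : ℝ) ≤ (sqNormInt V : ℝ) := by
      have : (0 : ℤ) ≤ sqNormInt V := by unfold sqNormInt; positivity
      exact_mod_cast this
    rw [norm_intVec, Real.sq_sqrt h0]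
  set w : E3 := ε • ((Real.sqrt N)⁻¹ • intVec h) with hw
  have hN0 : (0 : ℝ) < N := by exact_mod_cast Nat.pos_of_ne_zero hN
  have hsN : 0 < Real.sqrt N := Real.sqrt_pos.2 hN0
  have hwnorm : ‖w‖ = 1 := by
    have hu : ‖(Real.sqrt N)⁻¹ • intVec h‖ = 1 := by
      rw [norm_smul, norm_inv, Real.norm_of_nonneg hsN.le, norm_intVec, hh, Int.cast_natCast, inv_mul_cancel₀ hsN.ne']
    rcases hε with rfl | rfl
    · rw [hw, one_smul, hu]
    · rw [hw, neg_one_smul, norm_neg, hu]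
  have hinner : ⟪intVec V, w⟫ = (Real.sqrt N)⁻¹ * G := by
    rw [hw, real_inner_smul_right, real_inner_smul_right, inner_intVec, hGε]; ring
  have hsQ : 0 ≤ Real.sqrt Qn := Real.sqrt_nonneg _
  have hQQ : Real.sqrt Qn ^ 2 = Qn := Real.sq_sqrt (Nat.cast_nonneg _)
  have hNN : Real.sqrt N ^ 2 = N := Real.sq_sqrt hN0.le
  -- the squared form
  set L : ℝ := (sqNormInt V : ℝ) + Qn * (1 - (η : ℝ) ^ 2) with hL
  set R : ℝ := 2 * Real.sqrt Qn * ((Real.sqrt N)⁻¹ * G) with hR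
  have hη1' : (η : ℝ) ≤ 1 := by exact_mod_cast hη1
  have hη0' : (0 : ℝ) ≤ η := by exact_mod_cast hη0
  have hL0 : 0 ≤ L := by
    have h1 : (0 : ℝ) ≤ sqNormInt V := by rw [← norm_intVec_sq]; positivity
    have h2 : (0 : ℝ) ≤ 1 - (η : ℝ) ^ 2 := by nlinarith
    rw [hL]; positivity
  have hG0' : (0 : ℝ) ≤ G := by exact_mod_cast hG0
  have hR0 : 0 ≤ R := by rw [hR]; positivity
  have hLR : L ≤ R := by
    have hsq : L ^ 2 ≤ R ^ 2 := by
      have hc : (((sqNormInt V : ℚ) + Qn * (1 - η ^ 2)) ^ 2 * N : ℚ) ≤ 4 * Qn * (G : ℚ) ^ 2 := hcert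
      have hc' : L ^ 2 * N ≤ 4 * Qn * (G : ℝ) ^ 2 := by rw [hL]; exact_mod_cast hc
      have hR2 : R ^ 2 = 4 * Qn * (G : ℝ) ^ 2 / N := by
        rw [hR]; field_simp; rw [hQQ, hNN]; ring
      rw [hR2, le_div_iff₀ hN0]; exact hc'
    exact (pow_le_pow_iff_left₀ hL0 hR0 two_ne_zero).1 hsq
  have hsq : ‖intVec V - Real.sqrt Qn • w‖ ^ 2 ≤ (η * Real.sqrt Qn) ^ 2 := by
    rw [norm_sub_sq_real, norm_smul, Real.norm_of_nonneg hsQ, hwnorm, real_inner_smul_right, hinner, norm_intVec_sq, mul_one,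
      mul_pow, hQQ]
    rw [hL, hR] at hLR
    nlinarith
  exact (pow_le_pow_iff_left₀ (norm_nonneg _) (by positivity) two_ne_zero).1 hsq

/-! ## §3. The supercell enumeration -/

/-- The digits of `t < K³` in base `K = 2k₀+1`, shifted to `[−k₀, k₀]`. -/
def cellDigits (k₀ : ℕ) (t : Fin ((2 * k₀ + 1) ^ 3)) : Fin 3 → ℤ := fun k => ((finFunctionFinEquiv.symm t k : ℕ) : ℤ) - k₀

/-- Class label of the supercell point `q`. -/
def cellμ (N₀ k₀ : ℕ) (q : Fin (N₀ * (2 * k₀ + 1) ^ 3)) : Fin N₀ := (finProdFinEquiv.symm q).1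

/-- Lattice offset of the supercell point `q`. -/
def cellσ (N₀ k₀ : ℕ) (q : Fin (N₀ * (2 * k₀ + 1) ^ 3)) : Fin 3 → ℤ := cellDigits k₀ (finProdFinEquiv.symm q).2

/-- The middle digit vector (all digits `k₀`), i.e. the zero offset. -/
def cellMid (k₀ : ℕ) : Fin ((2 * k₀ + 1) ^ 3) := finFunctionFinEquiv fun _ => ⟨k₀, by omega⟩

/-- Index of the class centre `(m, 0)`. -/
def cellIdx (N₀ k₀ : ℕ) (m : Fin N₀) : Fin (N₀ * (2 * k₀ + 1) ^ 3) := finProdFinEquiv (m, cellMid k₀)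

/-- The digits are in `[−k₀, k₀]`. [folklore] -/
theorem abs_cellDigits_le (k₀ : ℕ) (t : Fin ((2 * k₀ + 1) ^ 3)) (k : Fin 3) : |cellDigits k₀ t k| ≤ k₀ := by
  have h := (finFunctionFinEquiv.symm t k).2
  unfold cellDigits
  rw [abs_le]
  constructor <;> omega

/-- `|cellσ q k| ≤ k₀`. [folklore] -/
theorem abs_cellσ_le (N₀ k₀ : ℕ) (q : Fin (N₀ * (2 * k₀ + 1) ^ 3)) (k : Fin 3) : |cellσ N₀ k₀ q k| ≤ k₀ :=
  abs_cellDigits_le k₀ _ k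

/-- `cellDigits` is injective. [folklore] -/
theorem cellDigits_injective (k₀ : ℕ) : Function.Injective (cellDigits k₀) := by
  intro t t' h
  apply finFunctionFinEquiv.symm.injective
  funext k
  have := congrFun h k
  simp only [cellDigits, sub_left_inj, Nat.cast_inj] at this
  exact Fin.ext this

/-- **The labels `(μ, σ)` are injective.** [folklore] -/
theorem cellμσ_injective (N₀ k₀ : ℕ) : Function.Injective fun q => (cellμ N₀ k₀ q, cellσ N₀ k₀ q) := by
  intro q q' h
  simp only [Prod.mk.injEq, cellμ, cellσ] at h
  apply finProdFinEquiv.symm.injective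
  exact Prod.ext h.1 (cellDigits_injective k₀ h.2)

/-- The digits of the middle vector are zero offsets. [folklore] -/
theorem cellDigits_mid (k₀ : ℕ) : cellDigits k₀ (cellMid k₀) = 0 := by
  funext k
  simp [cellDigits, cellMid]

/-- **The class centre has label `(m, 0)`.** [folklore] -/
theorem cellIdx_spec (N₀ k₀ : ℕ) (m : Fin N₀) : cellμ N₀ k₀ (cellIdx N₀ k₀ m) = m ∧ cellσ N₀ k₀ (cellIdx N₀ k₀ m) = 0 := by
  simp [cellμ, cellσ, cellIdx, cellDigits_mid]

/-- **Every `(m, s)` with `|s|_∞ ≤ k₀` is enumerated.** [folklore] -/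
theorem cell_sup (N₀ k₀ : ℕ) (m : Fin N₀) (s : Fin 3 → ℤ) (hs : ∀ k, |s k| ≤ k₀) :
    ∃ q, cellμ N₀ k₀ q = m ∧ cellσ N₀ k₀ q = s := by
  let f : Fin 3 → Fin (2 * k₀ + 1) := fun k => ⟨(s k + k₀).toNat, by have := abs_le.1 (hs k); omega⟩
  refine ⟨finProdFinEquiv (m, finFunctionFinEquiv f), by simp [cellμ], ?_⟩
  funext k
  have := abs_le.1 (hs k)
  simp only [cellσ, Equiv.symm_apply_apply, cellDigits, f]
  omega

/-- The supercell point with labels `(m', digits t)` — as a function of the pair. [folklore] -/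
theorem cellσ_eq (N₀ k₀ : ℕ) (q : Fin (N₀ * (2 * k₀ + 1) ^ 3)) : cellσ N₀ k₀ q = cellDigits k₀ (finProdFinEquiv.symm q).2 := rfl

/-- **Re-indexing sums over the supercell by (class, digit vector).** [folklore] -/
theorem sum_cell_eq (N₀ k₀ : ℕ) {β : Type*} [AddCommMonoid β] (f : Fin N₀ → Fin ((2 * k₀ + 1) ^ 3) → β) :
    ∑ q : Fin (N₀ * (2 * k₀ + 1) ^ 3), f (cellμ N₀ k₀ q) (finProdFinEquiv.symm q).2 = ∑ m, ∑ t, f m t := by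
  rw [← Fintype.sum_prod_type (fun p : Fin N₀ × Fin ((2 * k₀ + 1) ^ 3) => f p.1 p.2)]
  exact finProdFinEquiv.symm.sum_comp (fun p : Fin N₀ × Fin ((2 * k₀ + 1) ^ 3) => f p.1 p.2)

/-- A `∀` over the supercell from a `∀` over (class, digit vector). [folklore] -/
theorem forall_cell (N₀ k₀ : ℕ) {P : Fin N₀ → Fin ((2 * k₀ + 1) ^ 3) → Prop} (h : ∀ m t, P m t)
    (q : Fin (N₀ * (2 * k₀ + 1) ^ 3)) : P (cellμ N₀ k₀ q) (finProdFinEquiv.symm q).2 := h _ _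

/-- The digit value formula (for kernel-evaluable checkers): `cellDigits k₀ t k = (t / K^k % K) − k₀`. [folklore] -/
theorem cellDigits_val (k₀ : ℕ) (t : Fin ((2 * k₀ + 1) ^ 3)) (k : Fin 3) :
    cellDigits k₀ t k = (((t : ℕ) / (2 * k₀ + 1) ^ (k : ℕ) % (2 * k₀ + 1) : ℕ) : ℤ) - k₀ := by
  simp [cellDigits, finFunctionFinEquiv_symm_apply_val]

end Summit.AtomisticToContinuum.Crystallization.Theorems.FrustratedLawDichotomyCellKitF

end
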